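import Summits.Ventures.PercRepro.S1FiveCircuitsSolidBase

/-!
# PercRepro — THE SOLID ANALYSIS, CASE 1 (PART A): THE TWO-POINT BOUND, THE COLOOP STEP AND THE SWAP (p1, gen 33)

`proofs/P1-S2-CORANK6.md` §4l, Lemma A′ in `M`: `indep_pair_of_hfree` / `isCircuit_triple_of_dep_of_hfree` (an e-free core is simple),
`ncard_inter_le_two_of_not_subset` (a five-circuit outside a 7-point rank-`4` flat `S₀` meets it in `≤ 2` points), `subset_union_of_not_subset`
(the coloop step at nullity `4`), `exists_swap_of_not_subset` (two five-circuits through `e` outside `S₀` are `C` and `C − y + x` with `{e, x, y}`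
a circuit inside `S₀`). Part B (`S1FiveCircuitsSolidCaseOne`) counts. Split for the 400-line rule.
Axioms: standard.
-/

open scoped Matroid

namespace PercRepro

namespace S1

open Set

open FourCap

variable {α : Type}

/-- **An e-free core is simple**: two distinct points are independent (a point in the closure of another would lie in the closure of
one side of its own partition). -/
theorem indep_pair_of_hfree (M : Matroid α)
    (hfree : ∀ e ∈ M.E, ∃ A ⊆ M.E \ {e}, e ∉ M.closure A ∧ e ∉ M.closure ((M.E \ {e}) \ A))
    {a b : α} (ha : a ∈ M.E) (hb : b ∈ M.E) (hab : a ≠ b) : M.Indep {a, b} := by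
  have key : ∀ {p q : α}, p ∈ M.E → q ∈ M.E → p ≠ q → p ∉ M.closure {q} := by
    intro p q hp hq hpq hcl
    obtain ⟨A, _, hpA, hpB⟩ := hfree p hp
    by_cases hqA : q ∈ A
    · exact hpA (M.closure_mono (singleton_subset_iff.2 hqA) hcl)
    · exact hpB (M.closure_mono (singleton_subset_iff.2
        (show q ∈ (M.E \ {p}) \ A from ⟨⟨hq, fun h => hpq (mem_singleton_iff.1 h).symm⟩, hqA⟩)) hcl)
  rw [Matroid.indep_iff_forall_notMem_closure_sdiff (pair_subset ha hb)]
  intro x hx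
  rcases mem_insert_iff.1 hx with rfl | hx'
  · rw [pair_sdiff_left hab]
    exact key ha hb hab
  · rw [mem_singleton_iff.1 hx', pair_sdiff_right hab]
    exact key hb ha hab.symm

/-- **A dependent triple of an e-free core is a circuit** (its pairs are independent). -/
theorem isCircuit_triple_of_dep_of_hfree (M : Matroid α)
    (hfree : ∀ e ∈ M.E, ∃ A ⊆ M.E \ {e}, e ∉ M.closure A ∧ e ∉ M.closure ((M.E \ {e}) \ A))
    {a b c : α} (ha : a ∈ M.E) (hb : b ∈ M.E) (hc : c ∈ M.E) (hab : a ≠ b) (hac : a ≠ c) (hbc : b ≠ c)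
    (hdep : M.Dep {a, b, c}) : M.IsCircuit {a, b, c} := by
  rw [Matroid.isCircuit_iff_dep_forall_sdiff_singleton_indep]
  refine ⟨hdep, ?_⟩
  intro x hx
  simp only [mem_insert_iff, mem_singleton_iff] at hx
  rcases hx with rfl | rfl | rfl
  · rw [insert_sdiff_self_of_notMem (by simp [hab, hac])]
    exact indep_pair_of_hfree M hfree hb hc hbc
  · rw [insert_sdiff_of_notMem _ (by simp [hab]), pair_sdiff_left hbc]
    exact indep_pair_of_hfree M hfree ha hc hac
  · rw [insert_sdiff_of_notMem _ (by simp [hac]), pair_sdiff_right hbc]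
    exact indep_pair_of_hfree M hfree ha hb hab

/-- **A five-circuit outside the 7-point solid `S₀` meets it in at most two points** (under `¬h4`): four common points pull it in
(`subset_closure_of_four_le_ncard_inter`); three give `r(S₀ ∪ C) ≤ 4 + 4 − 3 = 5` on `7 + 5 − 3 = 9` points. -/
theorem ncard_inter_le_two_of_not_subset (M : Matroid α) [M.Finite]
    (hns : ¬ ∃ W ⊆ M.E, W.ncard ≤ 9 ∧ W.encard = M.eRk W + 4) {X : Set α} (hX4 : M.eRk X = 4)
    (h7 : (M.closure X).ncard = 7) {C : Set α} (hC : M.IsCircuit C) (h5 : C.ncard = 5) (hCS : ¬ C ⊆ M.closure X) :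
    (C ∩ M.closure X).ncard ≤ 2 := by
  have hS₀E : M.closure X ⊆ M.E := M.closure_subset_ground X
  have hCE := hC.subset_ground
  have hCf : C.Finite := M.ground_finite.subset hCE
  have hS₀f : (M.closure X).Finite := M.ground_finite.subset hS₀E
  have hS₀r : M.eRk (M.closure X) = 4 := by rw [M.eRk_closure_eq]; exact hX4
  by_contra hbig
  push Not at hbig
  by_cases h4 : 4 ≤ (C ∩ M.closure X).ncard
  · exact hCS (subset_closure_of_four_le_ncard_inter M hC h5 h4)
  have h3 : (C ∩ M.closure X).ncard = 3 := by omega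
  have hI : C ∩ M.closure X ⊂ C := by
    refine LE.le.ssubset_of_ne inter_subset_left ?_
    intro h
    rw [h] at h3
    omega
  have hIr : M.eRk (C ∩ M.closure X) = 3 := by
    rw [(hC.ssubset_indep hI).eRk_eq_encard, ← (hCf.subset inter_subset_left).cast_ncard_eq, h3]
    rfl
  have hr : M.eRk (M.closure X ∪ C) ≤ 5 := by
    have hsub := M.eRk_inter_add_eRk_union_le (M.closure X) C
    rw [inter_comm, hIr, hS₀r, eRk_eq_four_of_fiveCircuit M hC h5] at hsub
    obtain ⟨r, hr⟩ := exists_eRk_eq_coe M (M.closure X ∪ C)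
    rw [hr] at hsub ⊢
    have h' : 3 + r ≤ 4 + 4 := by exact_mod_cast hsub
    exact_mod_cast (show r ≤ 5 by omega)
  have hcard : (M.closure X ∪ C).ncard = 9 := by
    have := ncard_union_add_ncard_inter (M.closure X) C hS₀f hCf
    rw [inter_comm] at this
    omega
  have := S2.ncard_le_of_eRk_le_of_not_nullity M 4 9 (by norm_num) hns (union_subset hS₀E hCE) (r := 5)
    (by norm_num) hr
  omega

/-- **The coloop step**: at nullity `4`, a circuit `C ⊄ S₀` (any size) makes `S₀ ∪ C` a set of full nullity (`ν ≥ 3 + 1 − 0`: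
`S₀ ∩ C` is a proper subset of a circuit, hence independent), so every circuit of `M` lies inside `S₀ ∪ C` (the points outside
are coloops). -/
theorem subset_union_of_not_subset (M : Matroid α) [M.Finite] (hd : M.E.encard = M.eRank + 4)
    {X : Set α} (hX4 : M.eRk X = 4) (h7 : (M.closure X).ncard = 7)
    {C : Set α} (hC : M.IsCircuit C) (hCS : ¬ C ⊆ M.closure X)
    {C' : Set α} (hC' : M.IsCircuit C') : C' ⊆ M.closure X ∪ C := by
  have hS₀E : M.closure X ⊆ M.E := M.closure_subset_ground X
  have hCE := hC.subset_ground
  have hS₀f : (M.closure X).Finite := M.ground_finite.subset hS₀E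
  have hS₀r : M.eRk (M.closure X) = 4 := by rw [M.eRk_closure_eq]; exact hX4
  have hS₀3 : (M.closure X).encard = M.eRk (M.closure X) + 3 := by
    rw [← hS₀f.cast_ncard_eq, h7, hS₀r]
    norm_num
  have hC1 : C.encard = M.eRk C + 1 := hC.eRk_add_one_eq.symm
  have hI : M.closure X ∩ C ⊂ C := by
    refine LE.le.ssubset_of_ne inter_subset_right ?_
    intro h
    exact hCS (by rw [← h]; exact inter_subset_left)
  have hI0 : (M.closure X ∩ C).encard ≤ M.eRk (M.closure X ∩ C) + 0 := by
    rw [add_zero, (hC.ssubset_indep hI).eRk_eq_encard]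
  have hW := eRk_union_add_add_le_encard_add_of_nullity M hS₀E hCE hS₀3 hC1 hI0
  have hW4 : M.eRk (M.closure X ∪ C) + 4 ≤ (M.closure X ∪ C).encard := by
    have h := hW
    rw [Nat.cast_zero, add_zero, add_assoc] at h
    have h31 : ((3 : ℕ) : ℕ∞) + ((1 : ℕ) : ℕ∞) = 4 := by norm_num
    rwa [h31] at h
  intro x hx
  by_contra hxW
  exact hC'.not_isColoop_of_mem hx
    (isColoop_of_notMem_of_nullity_eq M (union_subset hS₀E hCE) hW4 hd (hC'.subset_ground hx) hxW)

/-- **Two five-circuits through `e` outside `S₀` differ by a swap along a circuit `{e, x, y}` inside `S₀`**: `C' = C − y + x`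
with `x, y ∈ S₀`, `y ∈ C ∖ C'`, `x ∈ C' ∖ C`, and `{e, x, y}` a circuit. -/
theorem exists_swap_of_not_subset (M : Matroid α) [M.Finite]
    (hfree : ∀ e ∈ M.E, ∃ A ⊆ M.E \ {e}, e ∉ M.closure A ∧ e ∉ M.closure ((M.E \ {e}) \ A))
    (hns : ¬ ∃ W ⊆ M.E, W.ncard ≤ 9 ∧ W.encard = M.eRk W + 4) (hd : M.E.encard = M.eRank + 4)
    {e : α} {X : Set α} (hX4 : M.eRk X = 4) (heX : e ∈ M.closure X) (h7 : (M.closure X).ncard = 7)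
    {C C' : Set α} (hC : M.IsCircuit C) (h5 : C.ncard = 5) (heC : e ∈ C) (hCS : ¬ C ⊆ M.closure X)
    (hC' : M.IsCircuit C') (h5' : C'.ncard = 5) (heC' : e ∈ C') (hC'S : ¬ C' ⊆ M.closure X) (hne : C ≠ C') :
    ∃ x y, x ∈ M.closure X ∧ y ∈ M.closure X ∧ y ∈ C ∧ x ∉ C ∧ y ≠ e ∧ x ≠ e ∧
      C' = insert x (C \ {y}) ∧ M.IsCircuit {e, x, y} := by
  have hS₀E : M.closure X ⊆ M.E := M.closure_subset_ground X
  have hCE := hC.subset_ground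
  have hC'E := hC'.subset_ground
  have hCf : C.Finite := M.ground_finite.subset hCE
  have hC'f : C'.Finite := M.ground_finite.subset hC'E
  have hS₀f : (M.closure X).Finite := M.ground_finite.subset hS₀E
  have heS₀ : e ∈ M.closure X := heX
  have hS₀r : M.eRk (M.closure X) = 4 := by rw [M.eRk_closure_eq]; exact hX4
  have hS₀3 : (M.closure X).encard = M.eRk (M.closure X) + 3 := by
    rw [← hS₀f.cast_ncard_eq, h7, hS₀r]
    norm_num
  -- (1) `C' ⊆ S₀ ∪ C`; (2) the two-point bounds
  have hC'W : C' ⊆ M.closure X ∪ C := subset_union_of_not_subset M hd hX4 h7 hC hCS hC'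
  have h2 := ncard_inter_le_two_of_not_subset M hns hX4 h7 hC h5 hCS
  have h2' := ncard_inter_le_two_of_not_subset M hns hX4 h7 hC' h5' hC'S
  -- (3)–(5): `|C ∩ C'| = 4`
  have hT4 : (C ∩ C').ncard = 4 := by
    have hsub : (C' \ M.closure X) ∪ {e} ⊆ C ∩ C' := by
      intro z hz
      rcases hz with hz | hz
      · exact ⟨(hC'W hz.1).resolve_left hz.2, hz.1⟩
      · rw [mem_singleton_iff.1 hz]; exact ⟨heC, heC'⟩
    have hdisj : Disjoint (C' \ M.closure X) {e} := disjoint_singleton_right.2 (fun h => h.2 heS₀)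
    have hcard1 : (C' ∩ M.closure X).ncard + (C' \ M.closure X).ncard = 5 := by
      rw [ncard_inter_add_ncard_sdiff_eq_ncard C' (M.closure X) hC'f, h5']
    have hcard2 : ((C' \ M.closure X) ∪ {e}).ncard = (C' \ M.closure X).ncard + 1 := by
      rw [ncard_union_eq hdisj (hC'f.subset sdiff_subset) (finite_singleton e), ncard_singleton]
    have hge : 4 ≤ (C ∩ C').ncard := by
      have := ncard_le_ncard hsub (hCf.subset inter_subset_left)
      omega
    have hle : (C ∩ C').ncard ≤ 4 := by
      by_contra hgt
      push Not at hgt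
      have h5'' : (C ∩ C').ncard ≤ 5 := by
        have := ncard_le_ncard (inter_subset_right : C ∩ C' ⊆ C') hC'f
        omega
      have heq : C ∩ C' = C' := eq_of_subset_of_ncard_le inter_subset_right (by omega) hC'f
      have hC'C : C' ⊆ C := by rw [← heq]; exact inter_subset_left
      exact hne (eq_of_subset_of_ncard_le hC'C (by omega) hCf).symm
    omega
  -- (6) the fifth points `y ∈ C ∖ C'`, `x ∈ C' ∖ C`
  have hCT : (C \ (C ∩ C')).ncard = 1 := by
    rw [ncard_sdiff' inter_subset_left hCf, h5, hT4]
  have hC'T : (C' \ (C ∩ C')).ncard = 1 := by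
    rw [ncard_sdiff' inter_subset_right hC'f, h5', hT4]
  obtain ⟨y, hy⟩ := ncard_eq_one.1 hCT
  obtain ⟨x, hx⟩ := ncard_eq_one.1 hC'T
  have hymem : y ∈ C \ (C ∩ C') := by rw [hy]; exact mem_singleton y
  have hxmem : x ∈ C' \ (C ∩ C') := by rw [hx]; exact mem_singleton x
  have hyC : y ∈ C := hymem.1
  have hyC' : y ∉ C' := fun h => hymem.2 ⟨hyC, h⟩
  have hxC' : x ∈ C' := hxmem.1
  have hxC : x ∉ C := fun h => hxmem.2 ⟨h, hxC'⟩
  have hye : y ≠ e := fun h => hyC' (h ▸ heC')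
  have hxe : x ≠ e := fun h => hxC (h ▸ heC)
  have hxy : x ≠ y := fun h => hxC (h ▸ hyC)
  have hTeq : C \ {y} = C ∩ C' := by rw [← hy, sdiff_sdiff_cancel_left inter_subset_left]
  have hC'eq : C' = insert x (C \ {y}) := by
    rw [hTeq, ← union_singleton, ← hx, union_sdiff_cancel inter_subset_right]
  -- (7) `U = C ∪ C' = insert x C`: six points of rank `4`, nullity `2`
  have hxcl : x ∈ M.closure C := by
    have h := hC'.subset_closure_sdiff_singleton x hxC'
    have hC'x : C' \ {x} = C ∩ C' := by
      conv_lhs => rw [hC'eq]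
      rw [insert_sdiff_self_of_notMem (fun h => hxC h.1), hTeq]
    rw [hC'x] at h
    exact M.closure_mono inter_subset_left h
  have hUE : insert x C ⊆ M.E := insert_subset (hC'E hxC') hCE
  have hUr : M.eRk (insert x C) = 4 := by
    apply le_antisymm
    · have := M.eRk_mono (insert_subset hxcl (M.subset_closure C hCE))
      rwa [M.eRk_closure_eq, eRk_eq_four_of_fiveCircuit M hC h5] at this
    · have := M.eRk_mono (subset_insert x C)
      rwa [eRk_eq_four_of_fiveCircuit M hC h5] at this
  have hU2 : (insert x C).encard = M.eRk (insert x C) + 2 := by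
    rw [← (hCf.insert x).cast_ncard_eq, ncard_insert_of_notMem hxC hCf, h5, hUr]
    norm_num
  -- (8) `S₀ ∩ U` is dependent (else `ν(S₀ ∪ U) ≥ 3 + 2 > 4`)
  have hdep : M.Dep (M.closure X ∩ insert x C) := by
    by_contra hind
    have hind' : M.Indep (M.closure X ∩ insert x C) :=
      Matroid.indep_of_not_dep hind (inter_subset_left.trans hS₀E)
    have hc : (M.closure X ∩ insert x C).encard ≤ M.eRk (M.closure X ∩ insert x C) + 0 := by
      rw [add_zero, hind'.eRk_eq_encard]
    have hW := eRk_union_add_add_le_encard_add_of_nullity M hS₀E hUE hS₀3 hU2 hc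
    have hmono := encard_le_eRk_add_of_subset M (union_subset hS₀E hUE) hd
    rw [Nat.cast_zero, add_zero] at hW
    obtain ⟨r, hr⟩ := exists_eRk_eq_coe M (M.closure X ∪ insert x C)
    have hnf : (M.closure X ∪ insert x C).Finite := hS₀f.union (hCf.insert x)
    rw [hr, ← hnf.cast_ncard_eq] at hW hmono
    have hW' : r + 3 + 2 ≤ (M.closure X ∪ insert x C).ncard := by exact_mod_cast hW
    have hmono' : (M.closure X ∪ insert x C).ncard ≤ r + 4 := by exact_mod_cast hmono
    omega
  -- (9) the circuit inside `S₀ ∩ U` lies in neither `C` nor `C'`, so it contains `x` and `y`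
  obtain ⟨K, hKsub, hK⟩ := hdep.exists_isCircuit_subset
  have hKS : K ⊆ M.closure X := hKsub.trans inter_subset_left
  have hKU : K ⊆ insert x C := hKsub.trans inter_subset_right
  have hKC : ¬ K ⊆ C := fun h => hCS (by rw [← hK.eq_of_subset_isCircuit hC h]; exact hKS)
  have hKC' : ¬ K ⊆ C' := fun h => hC'S (by rw [← hK.eq_of_subset_isCircuit hC' h]; exact hKS)
  have hxK : x ∈ K := by
    by_contra hxK
    exact hKC (fun k hk => (mem_insert_iff.1 (hKU hk)).resolve_left (fun h => hxK (h ▸ hk)))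
  have hyK : y ∈ K := by
    by_contra hyK
    refine hKC' (fun k hk => ?_)
    rcases mem_insert_iff.1 (hKU hk) with h | hkC
    · rw [h]; exact hxC'
    · rw [hC'eq]
      exact mem_insert_of_mem _ ⟨hkC, fun h => hyK (mem_singleton_iff.1 h ▸ hk)⟩
  have hxS : x ∈ M.closure X := hKS hxK
  have hyS : y ∈ M.closure X := hKS hyK
  -- (10) `C ∩ S₀ = {e, y}` and `C' ∩ S₀ = {e, x}`, so `K ⊆ {e, x, y}`
  have hCS₀ : C ∩ M.closure X = {e, y} := by
    symm
    refine eq_of_subset_of_ncard_le (pair_subset ⟨heC, heS₀⟩ ⟨hyC, hyS⟩) ?_ (hCf.subset inter_subset_left)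
    rw [ncard_pair hye.symm]
    exact h2
  have hC'S₀ : C' ∩ M.closure X = {e, x} := by
    symm
    refine eq_of_subset_of_ncard_le (pair_subset ⟨heC', heS₀⟩ ⟨hxC', hxS⟩) ?_ (hC'f.subset inter_subset_left)
    rw [ncard_pair hxe.symm]
    exact h2'
  have hKsub3 : K ⊆ {e, x, y} := by
    intro k hk
    rcases mem_insert_iff.1 (hKU hk) with h | hkC
    · rw [h]; exact mem_insert_of_mem _ (mem_insert _ _)
    · have hk' : k ∈ C ∩ M.closure X := ⟨hkC, hKS hk⟩
      rw [hCS₀] at hk'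
      rcases mem_insert_iff.1 hk' with h | h
      · rw [h]; exact mem_insert _ _
      · rw [mem_singleton_iff.1 h]; exact mem_insert_of_mem _ (mem_insert_of_mem _ (mem_singleton y))
  have heK : e ∈ K := by
    by_contra heK
    have hK2 : K ⊆ {x, y} := by
      intro k hk
      rcases mem_insert_iff.1 (hKsub3 hk) with h | h
      · exact absurd (h ▸ hk) heK
      · exact h
    exact hK.dep.not_indep ((indep_pair_of_hfree M hfree (hC'E hxC') (hCE hyC) hxy).subset hK2)
  have hKeq : K = {e, x, y} := by
    refine Subset.antisymm hKsub3 ?_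
    intro k hk
    rcases mem_insert_iff.1 hk with h | h
    · rw [h]; exact heK
    · rcases mem_insert_iff.1 h with h' | h'
      · rw [h']; exact hxK
      · rw [mem_singleton_iff.1 h']; exact hyK
  exact ⟨x, y, hxS, hyS, hyC, hxC, hye, hxe, hC'eq, hKeq ▸ hK⟩

end S1

end PercRepro
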